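import Literature.Geometry.Lorentzian.KerrSchildMultiplierCurrent
import Literature.Geometry.Lorentzian.MinkowskiRadialMultiplier
import Mathlib.Analysis.InnerProductSpace.PiL2
import Mathlib.Analysis.SpecificLimits.Basic

/-!
# Route ClusterCompleteness — crux `AdiabaticMultiKerrILED`: recession bookkeeping

Helper file for the crux `stmt-FinalStateConjecture-14310` (line `Sketch`, lead c6 wave 1, card
milne-hubble-current).

Two elementary bookkeeping facts of the Milne absorption argument for pairwise strictly receding
holes at lab positions `pᵢ + t vᵢ`:

* `norm_add_smul_sq_ge` — with `D = pᵢ − pⱼ`, `w = vᵢ − vⱼ` and `⟪D, w⟫ ≥ 0`, for `t ≥ 0` the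
  separation grows quadratically, `‖D + t w‖² = ‖D‖² + 2t⟪D, w⟫ + t²‖w‖² ≥ ‖D‖² + t²‖w‖²`
  (the causal-isolation input `dᵢⱼ(t) ≥ ‖w‖ t`);
* `tsum_inv_geometric` — over the geometric time slabs `tₘ = t₁ (1 + c)^m` the error terms
  `C/tₘ` are summable with `∑_{m ≥ m₀} 1/tₘ = (1 + c)/(c t_{m₀})` (geometric series with ratio
  `(1 + c)⁻¹`).

[folklore]
-/

noncomputable section

-- the doubled `FinalStateConjecture.FinalStateConjecture` path component trips dupNamespace
set_option linter.dupNamespace false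

open scoped BigOperators InnerProductSpace
open Literature.Geometry.Lorentzian

namespace Summit.FinalStateConjecture.FinalStateConjecture.Theorems

/-! ### Quadratic growth of the separation of strictly receding holes -/

/-- For `t ≥ 0` and `⟪D, w⟫ ≥ 0` the separation `‖D + t w‖` dominates both `‖D‖` and `t ‖w‖`:
`‖D‖² + t² ‖w‖² ≤ ‖D + t w‖²` (expand `‖D + t w‖² = ‖D‖² + 2t⟪D, w⟫ + t²‖w‖²` and drop the
non-negative cross term). [folklore] -/
theorem norm_add_smul_sq_ge : ∀ (D w : E3) (t : ℝ) (ht : 0 ≤ t) (hrec : 0 ≤ ⟪D, w⟫_ℝ), ‖D‖ ^ 2 + t ^ 2 * ‖w‖ ^ 2 ≤ ‖D + t • w‖ ^ 2 := by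
  intro D w t ht hrec
  rw [norm_add_sq_real, real_inner_smul_right, norm_smul, Real.norm_eq_abs, mul_pow, sq_abs]
  nlinarith [mul_nonneg ht hrec]

/-! ### The geometric-slab sum `∑ 1/tₘ` -/

/-- Termwise factorisation of the geometric-slab weights:
`(t₁ (1 + c)^(m₀ + m))⁻¹ = (t₁ (1 + c)^m₀)⁻¹ ((1 + c)⁻¹)^m`. [folklore] -/
theorem recession_inv_slab_eq (t₁ c : ℝ) (m₀ m : ℕ) :
    (t₁ * (1 + c) ^ (m₀ + m))⁻¹ = (t₁ * (1 + c) ^ m₀)⁻¹ * ((1 + c)⁻¹) ^ m := by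
  rw [pow_add, ← mul_assoc, mul_inv, inv_pow]

/-- The geometric-slab sum as a `HasSum` statement: for `t₁ > 0`, `c > 0`,
`∑_{m ≥ 0} (t₁ (1 + c)^(m₀ + m))⁻¹ = (1 + c) / (c t₁ (1 + c)^m₀)`. [folklore] -/
theorem recession_hasSum_inv_geometric (t₁ c : ℝ) (ht₁ : 0 < t₁) (hc : 0 < c) (m₀ : ℕ) :
    HasSum (fun m : ℕ ↦ (t₁ * (1 + c) ^ (m₀ + m))⁻¹) ((1 + c) / (c * (t₁ * (1 + c) ^ m₀))) := by
  have h1c : 0 < 1 + c := by linarith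
  have hr0 : 0 ≤ (1 + c)⁻¹ := inv_nonneg.mpr h1c.le
  have hr1 : (1 + c)⁻¹ < 1 := inv_lt_one_of_one_lt₀ (by linarith)
  have h := (hasSum_geometric_of_lt_one hr0 hr1).mul_left ((t₁ * (1 + c) ^ m₀)⁻¹)
  have hval : (t₁ * (1 + c) ^ m₀)⁻¹ * (1 - (1 + c)⁻¹)⁻¹ = (1 + c) / (c * (t₁ * (1 + c) ^ m₀)) := by
    field_simp [ht₁.ne', hc.ne', h1c.ne']
    ring
  have hfun : (fun m : ℕ ↦ (t₁ * (1 + c) ^ (m₀ + m))⁻¹) =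
      fun m ↦ (t₁ * (1 + c) ^ m₀)⁻¹ * ((1 + c)⁻¹) ^ m := by
    funext m
    exact recession_inv_slab_eq t₁ c m₀ m
  rw [hfun, ← hval]
  exact h

/-- The geometric-slab sum: over the slab times `tₘ = t₁ (1 + c)^m` (`t₁ > 0`, `c > 0`),
`∑_{m ≥ m₀} 1/tₘ = ∑_{m ≥ 0} (t₁ (1 + c)^(m₀ + m))⁻¹ = (1 + c) / (c t_{m₀})`. [folklore] -/
theorem tsum_inv_geometric : ∀ (t₁ c : ℝ) (ht₁ : 0 < t₁) (hc : 0 < c) (m₀ : ℕ), ∑' m : ℕ, (t₁ * (1 + c) ^ (m₀ + m))⁻¹ = (1 + c) / (c * (t₁ * (1 + c) ^ m₀)) := by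
  intro t₁ c ht₁ hc m₀
  exact (recession_hasSum_inv_geometric t₁ c ht₁ hc m₀).tsum_eq

end Summit.FinalStateConjecture.FinalStateConjecture.Theorems
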